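import Summits.QuantumFields.YangMills.Theorems.BalabanUVNodesN15TwoGridCovDPieceDefect
import Summits.QuantumFields.YangMills.Theorems.BalabanUVNodesN15CurvedGluingLocalGaugesTwoGridTwisted
import HarnessLib

/-!
# N15 = NE2, road (c) — PROGRAMME (PC), (PC-E-J) GROUNDWORK: THE GRADIENT ENTRY's TRANSPORTER LETTERS ARE NEEDED ONLY ON THE CUBE — THE SHIFTED PLATEAU OF A CUT PIECE AND THE
# LOCALIZED TRANSPORTER `R^ω = 1 + 1_S(B(x))·(R − 1)` (dag-n15-c g35, n15-c∕406)

Cell `pub-ymgap`, seat `pub-ymgap-dag-n15-c` (generation g35; R134 (a) seat, strategy s1 «first missing estimate»; HUMAN RULING D-0062; chair R424 venue).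
`bears_on: R4∕N15 · K3⁸ SpineGivenEndpointR13SepCoPHV (stmt-QuantumFields-27366)`; filed `--kind proof --supports stmt-QuantumFields-27366 --as helper` — COUNT-NEUTRAL.
FOUR lemmas, 0 `def`, 0 `sorry`.  Imports BY NAME n15-c∕400 `…TwoGridCovDPieceDefect` (`covD_comp_eq_fgrad_add`) and n15-c∕333 `…CurvedGluingLocalGaugesTwoGridTwisted`
(`mmulOp_comp_mulOp_fst_smul`); the n15-a∕b carriers `mmulOp`, `covD`, `pull`, `mulOp`, `ind`.

WHY.  n15-c∕404's displayed cube-gauge transporter letters `Σ_j|(n(R♯_k − 1))_{ij}| ≤ c_a` (`R♯_k(x) = W_k(x)R(x)W_k(x+e)ᵀ`, the transformed bond variable in the cube's gauge) and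
their two-grid fit `o_a` were displayed GLOBALLY in `x`; on sites the cube gauge `u′_k` controls `R♯_k` only on the cube's region ((3.35) there), so a global letter is `O(η⁻¹)`.
But `D_{R♯}∘(M_χ X)` reads `R♯(x)` only where `χ(x + e) ≠ 0`, i.e. on blocks of `S_k`:  (1) `τ_e^*∘(M_χ∘Z) = M_{1_S∘B}∘τ_e^*∘(M_χ∘Z)` when `χ(x+e) ≠ 0 ⟹ B(x) ∈ S`
(`pull_shift_comp_cut_eq_ind`); (2) hence `D_R∘(M_χ∘Z) = D_{R^ω}∘(M_χ∘Z)` with `R^ω(x) = 1 + 1_S(B(x))·(R(x) − 1)` (`covD_comp_cut_eq_covD_loc`, by n15-c∕400's split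
`D = ∇ + M_{n(R−1)}τ_e^*` and `M_A∘M_c = M_{cA}`); (3) the letters of `R^ω` are global from the letters of `R` ON `S` (`letter_loc_of_mem`), and (4) the two-grid row fit of
`n′(R′^ω − 1)` against `n(R^ω − 1)∘π` is global from the fit ON `S` (`fit_loc_of_mem`; the fine plateau is `1_S∘B∘π`, so the cut-offs agree exactly across `π`).  With these,
n15-c∕404∕405 are re-issued with the transporter letters and their fit required on the cube only (n15-c∕407∕408).

HONEST FRAMING ∕ LIMITS.  Generic algebra; nothing of [B9] asserted; NE2⁺ NOT PRINTED ∕ NOT proved; N15 of record untouched (DISCHARGED AS CONSUMED, p687738); K3⁸ OPEN; counts of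
record UNMOVED (typed 28∕28 · discharged 8∕27); one finite 𝕋⁴ at fixed ε per index — NOT infinite volume, NOT OS on ℝ⁴, NOT a mass gap, NOT Clay.  Restate-immune (no Theses import).
-/

set_option autoImplicit false

noncomputable section
open scoped BigOperators Matrix
open Finset

namespace Summit.QuantumFields.YangMills.BalabanUVNodes.N15.Gluing

open Literature.MathematicalPhysics.QuantumFieldTheory.Balaban1983to89
open Literature.MathematicalPhysics.QuantumFieldTheory.Balaban1983to89.T4EtaRateCoeffDefect (pull pull_apply)
open Literature.MathematicalPhysics.QuantumFieldTheory.Balaban1983to89.B6Prop26Gluing (mulOp mulOp_apply ind ind_of_mem ind_of_not_mem)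
open Summit.QuantumFields.YangMills.BalabanUVNodes.N15.MatrixSpecies (mmulOp liftEquiv liftEquiv_apply covD)
open Summit.QuantumFields.YangMills.BalabanUVNodes.N15.BackgroundLayer (fgrad)
open Summit.QuantumFields.YangMills.BalabanUVNodes.N15.CurvedSpecies (mmulOp_comp_mulOp_fst_smul)

variable {X X' : Type} [Fintype X] [DecidableEq X] {ι : Type} [Fintype ι] [DecidableEq ι] {g : B6.Geometry} (blk : X → g.Site) (π : X' → X)
  {F : Type} [AddCommGroup F] [Module ℝ F]

omit [Fintype X] [DecidableEq X] [Fintype ι] [DecidableEq ι] in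
/-- ★ **THE SHIFTED PLATEAU OF A CUT PIECE**: if `χ(x + e) ≠ 0 ⟹ B(x) ∈ S` then `τ_e^*∘(M_χ∘Z) = M_{1_S∘B}∘(τ_e^*∘(M_χ∘Z))` — the shifted cut piece lives on the blocks of `S`. [folklore] -/
theorem pull_shift_comp_cut_eq_ind (s : X ≃ X) {χ : X → ℝ} {S : Set g.Site} (hS : ∀ x, χ (s x) ≠ 0 → blk x ∈ S) (Z : F →ₗ[ℝ] (X × ι → ℝ)) :
    pull (liftEquiv s ι) ∘ₗ (mulOp (fun p : X × ι => χ p.1) ∘ₗ Z) =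
      mulOp (fun p : X × ι => ind S (blk p.1)) ∘ₗ (pull (liftEquiv s ι) ∘ₗ (mulOp (fun p : X × ι => χ p.1) ∘ₗ Z)) := by
  refine LinearMap.ext fun f => funext fun p => ?_
  simp only [LinearMap.comp_apply, pull_apply, mulOp_apply, liftEquiv_apply]
  by_cases h : χ (s p.1) = 0
  · rw [h, zero_mul, mul_zero]
  · rw [ind_of_mem (hS p.1 h), one_mul]

omit [Fintype X] [DecidableEq X] in
/-- ★★ **THE LOCALIZED TRANSPORTER**: `D_R∘(M_χ∘Z) = D_{R^ω}∘(M_χ∘Z)`, `R^ω(x) = 1 + 1_S(B(x))·(R(x) − 1)`, whenever `χ(x + e) ≠ 0 ⟹ B(x) ∈ S` — by n15-c∕400's split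
`D_R∘Y = ∇∘Y + M_{n(R−1)}∘τ_e^*∘Y`, the shifted plateau and `M_A∘M_c = M_{cA}`: the covariant derivative of a cut piece reads the transporter only on the cube.
[cite: Balaban1985BackgroundPropagators, (3.50) p.400 (species: shape)] -/
theorem covD_comp_cut_eq_covD_loc (n : ℝ) (R : X → Matrix ι ι ℝ) (s : X ≃ X) {χ : X → ℝ} {S : Set g.Site} (hS : ∀ x, χ (s x) ≠ 0 → blk x ∈ S)
    (Z : F →ₗ[ℝ] (X × ι → ℝ)) :
    covD n⁻¹ R s ∘ₗ (mulOp (fun p : X × ι => χ p.1) ∘ₗ Z) =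
      covD n⁻¹ (fun x => 1 + ind S (blk x) • (R x - 1)) s ∘ₗ (mulOp (fun p : X × ι => χ p.1) ∘ₗ Z) := by
  rw [covD_comp_eq_fgrad_add, covD_comp_eq_fgrad_add]
  congr 1
  conv_lhs => rw [pull_shift_comp_cut_eq_ind blk s hS Z, ← LinearMap.comp_assoc,
    mmulOp_comp_mulOp_fst_smul (fun x => ind S (blk x)) (fun x => n • (R x - 1))]
  refine congrArg (fun A : X → Matrix ι ι ℝ => mmulOp A ∘ₗ (pull (liftEquiv s ι) ∘ₗ (mulOp (fun p : X × ι => χ p.1) ∘ₗ Z))) (funext fun x => ?_)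
  rw [add_sub_cancel_left]
  exact smul_comm _ _ _

omit [Fintype X] [DecidableEq X] in
/-- ★ **LETTERS OF THE LOCALIZED TRANSPORTER** are global from the letters ON `S`: `Σ_j|(n(R^ω − 1))_{ij}| ≤ c_a` everywhere from `Σ_j|(n(R − 1))_{ij}| ≤ c_a` where `B(x) ∈ S`.
[folklore] -/
theorem letter_loc_of_mem {n ca : ℝ} (hca : 0 ≤ ca) {R : X → Matrix ι ι ℝ} {S : Set g.Site}
    (ha : ∀ x, blk x ∈ S → ∀ i, ∑ j, |(n • (R x - 1)) i j| ≤ ca) (x : X) (i : ι) :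
    ∑ j, |(n • ((1 + ind S (blk x) • (R x - 1)) - 1)) i j| ≤ ca := by
  rw [add_sub_cancel_left, smul_comm]
  by_cases hx : blk x ∈ S
  · rw [ind_of_mem hx, one_smul]; exact ha x hx i
  · rw [ind_of_not_mem hx, zero_smul]; simpa using hca

omit [Fintype X] [DecidableEq X] in
/-- ★ **THE TWO-GRID FIT OF THE LOCALIZED TRANSPORTER LETTERS** is global from the fit ON `S` — the fine plateau is `1_S∘B∘π`, so the cut-offs agree exactly across `π`:
`Σ_j|(n′(R′^ω − 1))(x′) − (n(R^ω − 1))(πx′)|_{ij} ≤ o_a` everywhere from the same ON `S` (the input of n15-b `hasMaj_idef_mmulOp`). [folklore] -/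
theorem fit_loc_of_mem {n n' oa : ℝ} (hoa : 0 ≤ oa) {R : X → Matrix ι ι ℝ} {R' : X' → Matrix ι ι ℝ} {S : Set g.Site}
    (hDa : ∀ x', blk (π x') ∈ S → ∀ i, ∑ j, |(n' • (R' x' - 1) - n • (R (π x') - 1)) i j| ≤ oa) (x' : X') (i : ι) :
    ∑ j, |(n' • ((1 + ind S ((blk ∘ π) x') • (R' x' - 1)) - 1)) i j - (n • ((1 + ind S (blk (π x')) • (R (π x') - 1)) - 1)) i j| ≤ oa := by
  simp only [Function.comp_apply, add_sub_cancel_left]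
  by_cases hx : blk (π x') ∈ S
  · simp only [ind_of_mem hx, one_smul]
    simpa only [Matrix.sub_apply] using hDa x' hx i
  · simp only [ind_of_not_mem hx, zero_smul, smul_zero, Matrix.zero_apply, sub_self, abs_zero, Finset.sum_const_zero]
    exact hoa

end Summit.QuantumFields.YangMills.BalabanUVNodes.N15.Gluing

end
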